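import Summits.BirchSwinnertonDyer.BirchSwinnertonDyer.Theorems.AdditiveKolyvaginRoadBottomTransferKrizLiDepletion
import HarnessLib

/-!
# Route `AdditiveKolyvaginRoad`, crux KS′ `LevelKolyvaginSystemsAdditive` (item stmt-BirchSwinnertonDyer-21396):
# ON THE (γ)-AVATAR LOCUS OF LINE `epsilon_matched_retyping` THE ROUTE's CRUX r2 (KPA′) ALREADY HOLDS AT CONDUCTOR 1
# (cell `pub/bsd-wall`, lead `cruxlead-stmt-BirchSwinnertonDyer-21396`; `--supports stmt-BirchSwinnertonDyer-21396`, helper — a ROUTE-LEVEL READING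
# for the planners, recorded as a kernel-checked statement)

WHY. Width seat w3's conductor-one bottom transfer (`AdditiveKoly.kolyvaginClass_one_ne_zero_of_thm116_of_lossless`, p605382; `hdep_of_sign`,
p605510) proves, from Kriz–Li Thm. 1.16 BY NAME and a (γ)-avatar (sign agreement + log certificate), that EVERY conductor-one
Kolyvagin–Heegner datum of the additive curve `E` has non-zero class mod `p`. This file records the consequence in the EXACT conclusion shape of
the route's crux r2 `KolyvaginPrimitiveAdditive` (item stmt-BirchSwinnertonDyer-21400: `∃ n d, KolSupp (IsKolyvaginPrime …) n ∧ d.kolyvaginClass ≠ 0`)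
with `n = 1`: on the (γ)-avatar locus the route's downstream crux is settled at conductor one modulo Kriz–Li 1.16, so the level systems KS′ (this
item) are consumed by nothing downstream THERE — they matter off the locus. Route shape is the planners' business (D-0019); this file only makes
the observation checkable.

* `kolyvaginPrimitiveAdditive_conclusion_on_gammaLocus` — frame ∧ (γ)-avatar ∧ `hKL` ⟹ KPA′'s conclusion at the frame.

HONEST FRAMING: one theorem; 0 definitions, 0 named facts, 0 `sorry`; CONDITIONAL on `hKL` (Kriz–Li 2019 Thm. 1.16, refereed, typed named fact).
Closes nothing: KPA′ (21400) quantifies over ALL ♯ frames; this is its fibre on a sub-locus. BSD is NOT proved by any of this.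

References: [cite: KrizLi2019, Thm. 1.16, Rem. 1.17] [cite: GrossLMS1991, §3, §4 (4.4)] [cite: WZhang2014, Thm. 1.1].
-/

set_option linter.dupNamespace false -- single-conjunct summit repeats the name by design

noncomputable section

open scoped Classical

namespace Summit.BirchSwinnertonDyer.BirchSwinnertonDyer.Theorems.AdditiveKoly

open WeierstrassCurve NumberField IsDedekindDomain Field
  Literature.NumberTheory.EllipticCurves Literature.NumberTheory.EllipticCurves.ModularForms
  Literature.NumberTheory.EllipticCurves.Rank1Residual Literature.NumberTheory.GaloisRepresentations
  Summit.BirchSwinnertonDyer.Rank1Residual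

variable (W : WeierstrassCurve ℚ) [W.IsElliptic] [W.IsGloballyMinimal] [NeZero (W.conductorNorm ℤ)]
  (p : ℕ) [hp : Fact p.Prime] (K : Type) [Field K] [NumberField K]
  (Dt : ModularParametrizationData W (W.conductorNorm ℤ)) (β : ℤ) (ι : K →+* ℂ)

/-- **KPA′'s conclusion on the (γ)-avatar locus.** Frame: `E = W` globally minimal, ADDITIVE at `p ≥ 5`, `ρ̄_{E,p}` onto, `K` imaginary
quadratic with `d_K < −4`, Heegner hypothesis for `N_E`, `4N_E ∣ β² − d_K`, `p ∤ c(Dt)`. Avatar `E₀ = W₀`: globally minimal, `Γ_ℚ`-equivariant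
`E[p] ≃ E₀[p]`, GOOD NON-ANOMALOUS at `p`, `hrad`, `htype`, SIGN AGREEMENT at the multiplicative primes, Heegner hypothesis for `N₀`, `p ∤ c(Dt₀)`,
and the LOG CERTIFICATE along `ιp`. Input BY NAME: Kriz–Li Thm. 1.16. CONCLUSION (the shape of `Theses.AdditiveKolyvaginRoad.KolyvaginPrimitiveAdditive`
at this frame): some Kolyvagin–Heegner datum of Kolyvagin-prime support — here of conductor `1` — has `c(1) ≠ 0` in `H¹(K, E[p])`.
[cite: KrizLi2019, Thm. 1.16, Rem. 1.17] [cite: GrossLMS1991, §4 (4.4)] -/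
theorem kolyvaginPrimitiveAdditive_conclusion_on_gammaLocus (hKL : KrizLi2019.thm116_padicLogHeegner_congruence)
    (hp5 : 5 ≤ p) (hadd : Addv W p) (hs : W.HasSurjectiveModNGaloisRep p)
    (hK : IsImaginaryQuadratic K) (hlt : NumberField.discr K < -4)
    (hH : SatisfiesHeegnerHypothesis (W.conductorNorm ℤ) K)
    (hβ : (4 * (W.conductorNorm ℤ : ℤ)) ∣ β ^ 2 - NumberField.discr K) (hc : ¬ (p : ℤ) ∣ Dt.c)
    (W₀ : WeierstrassCurve ℚ) [W₀.IsElliptic] [W₀.IsGloballyMinimal] [NeZero (W₀.conductorNorm ℤ)]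
    (e : geomTorsion W (p : ℤ) ≃+ geomTorsion W₀ (p : ℤ))
    (he : ∀ (σ : absoluteGaloisGroup ℚ) (T : geomTorsion W (p : ℤ)), e (σ • T) = σ • e T)
    (hgood₀ : W₀.HasGoodReductionAtPrime p) (hna : ¬ (p : ℤ) ∣ W₀.frobeniusTrace p - 1)
    (hrad : ∀ q : ℕ, q.Prime → (q ∣ p * W.conductorNorm ℤ ↔ q ∣ p * W₀.conductorNorm ℤ))
    (htype : ∀ (ℓ : ℕ) [Fact ℓ.Prime], W.HasMultiplicativeReductionAtPrime ℓ ↔ W₀.HasMultiplicativeReductionAtPrime ℓ)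
    (hsign : ∀ (ℓ : ℕ) [Fact ℓ.Prime], W₀.HasMultiplicativeReductionAtPrime ℓ → W.LFunction ℓ = W₀.LFunction ℓ)
    (Dt₀ : ModularParametrizationData W₀ (W₀.conductorNorm ℤ)) (hc₀ : ¬ (p : ℤ) ∣ Dt₀.c)
    (hH₀ : SatisfiesHeegnerHypothesis (W₀.conductorNorm ℤ) K) (ιp : K →+* ℚ_[p])
    (hcert : ∃ (H₀ : HeegnerDatum (W₀.conductorNorm ℤ) (NumberField.discr K)) (y₀ : (W₀.baseChange K).toAffine.Point),
      WeierstrassCurve.Affine.Point.map ι.toRatAlgHom y₀ = heegnerPointComplex Dt₀ H₀ ∧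
        ¬ ∃ Q : (W₀.baseChange ℚ_[p]).toAffine.Point, (p : ℤ) • Q = X11b.padicPointOf W₀ p ιp y₀) :
    ∃ (n : ℕ) (d : KolyvaginHeegnerData Dt β ι n),
      KolyvaginDescent.KolSupp (Zhang2014.IsKolyvaginPrime (W.conductorNorm ℤ) W K p) n ∧
        d.kolyvaginClass (Fact.out : p.Prime) 1 ≠ 0 := by
  -- `p` splits in `K`: `p ∣ N_E` (additive reduction) and `K` is Heegner for `N_E`
  have hsplit : ((Ideal.span {(p : ℤ)}).primesOver (𝓞 K)).ncard = 2 :=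
    hH p hp.out ((W.dvd_conductorNorm_iff_not_hasGoodReductionAtPrime p).mpr hadd.1)
  obtain ⟨d⟩ := nonempty_kolyvaginHeegnerData_one W K Dt β ι hK hβ
  exact ⟨1, d, KolyvaginDescent.kolSupp_one _,
    kolyvaginClass_one_ne_zero_of_thm116_of_lossless W p K Dt β ι hKL hp5 hadd hs hK hlt hH hc W₀ e he hgood₀ hna
      (hdep_of_sign W W₀ p hrad htype hsign) Dt₀ hc₀ hH₀ hsplit ιp hcert d⟩

end Summit.BirchSwinnertonDyer.BirchSwinnertonDyer.Theorems.AdditiveKoly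

end
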